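import Summits.AtomisticToContinuum.HydrodynamicLimit.Theorems.JParityClosureLocalSecondLawLedgerDefs
import Summits.AtomisticToContinuum.HydrodynamicLimit.Theorems.JParityClosureDensityCapGridUpgrade
import Summits.AtomisticToContinuum.HydrodynamicLimit.Theorems.JParityClosureDensityCapMeanDisplacement
import Literature.MathematicalPhysics.KineticTheory.HardSphereEulerProofs

/-!
# Density-only history net for stub T (`stub_historyNet`) of the line `contact-asymmetry-information`
(crux `JParityClosure.LocalSecondLaw`, stmt-AtomisticToContinuum-13081; registered sub-lemma `contactT_densityHistoryNet`)

Stub T of the line asks for a finite `η′`-net, of `N`-INDEPENDENT size `M`, of the coarse histories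
`s ↦ (ρ_r, m_r, e_r)(Φₛz)` in sup-norm on `[0, τ] × 𝕋³`, outside an event of local-Gibbs mass `≤ δ′`, eventually in
`N` at fixed `r` (`Theorems/JParityClosureLocalSecondLawContactDefs.lean`, `Pin`).  This file proves the DENSITY part
(`contactT_densityHistoryNet`): the coarse density history alone admits such a net, with centres that do not even
depend on `N`.  Ingredients, all landed: on a good orbit of kinetic energy per particle `≤ K` the mollified density
`ρ_r ∈ [0, 3/(πr³)]` is `3/(πr⁴)`-Lipschitz in the centre (`gridUp_abs_mollDensity_sub_le_centre`) and
`3/(πr⁴)√(2K)`-Lipschitz in time (the Lipschitz clock `gridUp_clock` over the mean displacement bound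
`stub_meanDisplacement` — positions are continuous and move with the velocities between collisions, Cauchy–Schwarz,
energy conservation); finite nets of `𝕋³` and `[0, τ]` (`gridUp_euclidNet`, `gridUp_timeNet`); rounding the grid
values to multiples of `η′/4` (an explicit Arzelà–Ascoli net of piecewise-constant centres, `M = levels ^ net points`);
the bad set is law-null (`gridUp_localGibbsLaw_compl_good`); and energy tightness under the local Gibbs law for
GENERAL continuous profiles and `σ ≤ 1/2` (`densityNet_energyTight`, from the conditional Bienaymé–Chebyshev bound
`tendsto_localGibbsMeasure_velFluct` of `HardSphereEulerProofs`; no law of large numbers is used).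

What is NOT here (and why stub T is not closed by this file): the momentum and energy histories `m_r`, `e_r` jump at
collisions (`Δm_r(x) = (N+1)⁻¹ (b_r(xᵢ,x) − b_r(xⱼ,x)) Δvᵢ`, `|b_r(xᵢ,·) − b_r(xⱼ,·)| ≤ 3ε/(πr⁴)`), so a sup-norm net
for them needs an a-priori modulus, uniform over short time windows and with high probability, of the cumulative
collision activity `(ε/(N+1)) ∑_{collisions in the window} |g·ω|` (and, for `e_r`, of the empirical cubic velocity
moment along the flow); no such bound is in the tree (the total-count tightness `CollisionTightness`, stmt-13085, is
open beyond its equilibrium rung).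

References: C. Kipnis, C. Landim, *Scaling Limits of Interacting Particle Systems* (1999), Ch. 4 (from fixed-time to
uniform-in-time statements through moduli of continuity); H. Spohn, *Large Scale Dynamics of Interacting Particles*
(1991), Part I §3 (setting).
-/

noncomputable section

open scoped BigOperators Topology Classical MeasureTheory ENNReal InnerProductSpace
open Filter Set MeasureTheory Function
open Literature.MathematicalPhysics.KineticTheory
open Literature.Analysis.FluidPDE
open Summit.AtomisticToContinuum.HydrodynamicLimit.Theorems.LocalSecondLawNegative
open Summit.AtomisticToContinuum.HydrodynamicLimit.Theorems.LocalSecondLawLedger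

namespace Summit.AtomisticToContinuum.HydrodynamicLimit.Theorems.LocalSecondLawContact

/-- **Energy tightness under the local Gibbs law** (no law of large numbers needed): for continuous profiles
`a₀, θ₀ > 0`, `u₀` and `σ ≤ 1/2` there is `K ≥ 0` with `P_N(K < (N+1)⁻¹ · configEnergy) → 0`; indeed with
`K = U²/2 + 3Θ/2 + 1` (`U`, `Θ` sup bounds of `‖u₀‖`, `θ₀`) the event forces the centred velocity average
`(N+1)⁻¹ ∑ᵢ (‖vᵢ‖²/2 − ‖u₀(xᵢ)‖²/2 − 3θ₀(xᵢ)/2)` above `1`, which is `O((N+1)⁻¹)` in probability by the conditional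
Bienaymé–Chebyshev bound `tendsto_localGibbsMeasure_velFluct`. -/
theorem densityNet_energyTight {a₀ θ₀ : T3 → ℝ} {u₀ : T3 → V3} (ha : Continuous a₀) (hθ : Continuous θ₀)
    (hu : Continuous u₀) (ha0 : ∀ x, 0 < a₀ x) (hθ0 : ∀ x, 0 < θ₀ x) {σ : ℝ} (hσ2 : σ ≤ 1 / 2)
    (Φ : (N : ℕ) → Flow σ N) :
    ∃ K : ℝ, 0 ≤ K ∧ Tendsto (fun N => localGibbsLaw σ a₀ u₀ θ₀ N (Φ N)
      {z | K < ((N + 1 : ℕ) : ℝ)⁻¹ * configEnergy z}) atTop (𝓝 0) := by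
  obtain ⟨Θ, hΘ0, hΘ⟩ := exists_forall_abs_le_of_continuous hθ
  obtain ⟨U, hU0, hU⟩ := exists_forall_abs_le_of_continuous (continuous_norm.comp hu)
  set E₀ : ℝ := U ^ 2 / 2 + 3 / 2 * Θ with hE₀def
  have hE₀ : 0 ≤ E₀ := by positivity
  refine ⟨E₀ + 1, by positivity, ?_⟩
  set Y : T3 → V3 → ℝ := fun x v => ‖v‖ ^ 2 / 2 - ‖u₀ x‖ ^ 2 / 2 - Fintype.card (Fin 3) * θ₀ x / 2
    with hYdef
  have hYm : Measurable fun p : T3 × V3 => Y p.1 p.2 := by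
    rw [hYdef]
    fun_prop
  have hmem : ∀ x, MemLp (Y x) 2 (gaussMeasure (u₀ x) (θ₀ x)) := by
    intro x
    have : Y x = fun v => ‖v‖ ^ 2 / 2 - (‖u₀ x‖ ^ 2 / 2 + Fintype.card (Fin 3) * θ₀ x / 2) := by
      funext v
      simp only [hYdef]
      ring
    rw [this]
    exact memLp_energy_gaussMeasure _ _ _
  have hY0 : ∀ x, ∫ v, Y x v ∂gaussMeasure (u₀ x) (θ₀ x) = 0 := fun x =>
    integral_energy_gaussMeasure (u₀ x) (hθ0 x)
  have hYB : ∀ x, ProbabilityTheory.variance (Y x) (gaussMeasure (u₀ x) (θ₀ x)) ≤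
      2 * 3 * Θ * U ^ 2 + Θ ^ 2 / 2 * gaussFourthMomentConst (Fin 3) := by
    intro x
    rw [ProbabilityTheory.variance_eq_sub (hmem x), hY0 x]
    simp only [ne_eq, OfNat.ofNat_ne_zero, not_false_eq_true, zero_pow, sub_zero]
    have hθx : 0 ≤ θ₀ x := (hθ0 x).le
    have hθΘ : θ₀ x ≤ Θ := (le_abs_self _).trans (hΘ x)
    have huU : ‖u₀ x‖ ≤ U := (le_abs_self _).trans (hU x)
    have h1 : θ₀ x * ‖u₀ x‖ ^ 2 ≤ Θ * U ^ 2 :=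
      mul_le_mul hθΘ (pow_le_pow_left₀ (norm_nonneg _) huU 2) (sq_nonneg _) hΘ0
    have h2 : θ₀ x ^ 2 * gaussFourthMomentConst (Fin 3) ≤ Θ ^ 2 * gaussFourthMomentConst (Fin 3) :=
      mul_le_mul_of_nonneg_right (pow_le_pow_left₀ hθx hθΘ 2) gaussFourthMomentConst_nonneg
    calc ∫ v, ((Y x) ^ 2) v ∂gaussMeasure (u₀ x) (θ₀ x)
        = ∫ v, (‖v‖ ^ 2 / 2 - ‖u₀ x‖ ^ 2 / 2 - Fintype.card (Fin 3) * θ₀ x / 2) ^ 2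
            ∂gaussMeasure (u₀ x) (θ₀ x) := rfl
      _ ≤ 2 * Fintype.card (Fin 3) * θ₀ x * ‖u₀ x‖ ^ 2 +
            θ₀ x ^ 2 / 2 * gaussFourthMomentConst (Fin 3) :=
          integral_energy_sq_gaussMeasure_le (u₀ x) (hθ0 x)
      _ ≤ 2 * 3 * Θ * U ^ 2 + Θ ^ 2 / 2 * gaussFourthMomentConst (Fin 3) := by
          simp only [Fintype.card_fin, Nat.cast_ofNat]
          linarith
  have hA := tendsto_localGibbsMeasure_velFluct ha hθ hu ha0 hθ0 hσ2 hYm hmem hY0 hYB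
    (continuous_const (y := (1 : ℝ))) (η := 1) one_pos
  refine tendsto_of_tendsto_of_tendsto_of_le_of_le tendsto_const_nhds hA (fun _ => zero_le) fun N => ?_
  rw [localGibbsLaw_eq]
  refine measure_mono fun z hz => ?_
  simp only [Set.mem_setOf_eq, one_mul] at hz ⊢
  have hN : (0 : ℝ) < ((N + 1 : ℕ) : ℝ) := by positivity
  have hsplit : ((N + 1 : ℕ) : ℝ)⁻¹ * configEnergy z =
      ((N + 1 : ℕ) : ℝ)⁻¹ * ∑ i, Y (z i).1 (z i).2 +
        ((N + 1 : ℕ) : ℝ)⁻¹ * ∑ i, (‖u₀ (z i).1‖ ^ 2 / 2 + Fintype.card (Fin 3) * θ₀ (z i).1 / 2) := by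
    rw [← mul_add, ← Finset.sum_add_distrib]
    congr 1
    unfold configEnergy
    rw [Finset.mul_sum]
    refine Finset.sum_congr rfl fun i _ => ?_
    simp only [hYdef]
    ring
  have hrest : ((N + 1 : ℕ) : ℝ)⁻¹ * ∑ i, (‖u₀ (z i).1‖ ^ 2 / 2 + Fintype.card (Fin 3) * θ₀ (z i).1 / 2) ≤ E₀ := by
    have hterm : ∀ i : Fin (N + 1), ‖u₀ (z i).1‖ ^ 2 / 2 + Fintype.card (Fin 3) * θ₀ (z i).1 / 2 ≤ E₀ := by
      intro i
      have hθΘ : θ₀ (z i).1 ≤ Θ := (le_abs_self _).trans (hΘ _)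
      have huU : ‖u₀ (z i).1‖ ≤ U := (le_abs_self _).trans (hU _)
      have hu2 : ‖u₀ (z i).1‖ ^ 2 ≤ U ^ 2 := pow_le_pow_left₀ (norm_nonneg _) huU 2
      simp only [Fintype.card_fin, Nat.cast_ofNat, hE₀def]
      linarith
    calc ((N + 1 : ℕ) : ℝ)⁻¹ * ∑ i, (‖u₀ (z i).1‖ ^ 2 / 2 + Fintype.card (Fin 3) * θ₀ (z i).1 / 2)
        ≤ ((N + 1 : ℕ) : ℝ)⁻¹ * ∑ _i : Fin (N + 1), E₀ := by
          gcongr with i _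
          exact hterm i
      _ = E₀ := by
          rw [Finset.sum_const, Finset.card_univ, Fintype.card_fin, nsmul_eq_mul, ← mul_assoc,
            inv_mul_cancel₀ hN.ne', one_mul]
  have h1 : 1 < ((N + 1 : ℕ) : ℝ)⁻¹ * ∑ i, Y (z i).1 (z i).2 := by linarith
  exact h1.le.trans (le_abs_self _)

/-- **T (density part) · `contactT_densityHistoryNet`** — the DENSITY-ONLY history net of stub T (`stub_historyNet`)
of the line `contact-asymmetry-information`: for `σ < 1/2`, every flow family, horizon `τ`, resolution `η′`,
tolerance `δ′` and radius `r` there is an `N`-INDEPENDENT number `M` of deterministic density histories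
`c_j : ℝ → 𝕋³ → ℝ` such that, eventually in `N`, all but `δ′` of the local-Gibbs mass has its coarse density history
`(s, x) ↦ ρ_r(Φₛz)(x)` within `η′` of one `c_j` in sup-norm on `[0, τ] × 𝕋³`.  Proof: on the good set with kinetic
energy per particle `≤ K`, `ρ_r ∈ [0, 3/(πr³)]` is `3/(πr⁴)`-Lipschitz in the centre
(`gridUp_abs_mollDensity_sub_le_centre`) and `3/(πr⁴)√(2K)`-Lipschitz in time (the Lipschitz clock `gridUp_clock` of
the mean displacement bound `stub_meanDisplacement`: positions move continuously with the velocities, Cauchy–Schwarz and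
energy conservation); rounding the values at the points of a finite space–time net (`gridUp_euclidNet`,
`gridUp_timeNet`) to multiples of `η′/4` gives an explicit finite family of piecewise-constant centres (Arzelà–Ascoli by
hand), of cardinality `M = (levels)^(net points)`; the bad set is law-null (`gridUp_localGibbsLaw_compl_good`) and
`P_N(K < energy) ≤ δ′` eventually (`densityNet_energyTight`).  The centres do not even depend on `N`.  The momentum and
energy parts of stub T need in addition an a-priori modulus of the cumulative collision activity over short time
windows (not in the tree). -/
theorem contactT_densityHistoryNet : ∀ (a₀ θ₀ : T3 → ℝ) (u₀ : T3 → V3), Continuous a₀ → Continuous θ₀ → Continuous u₀ → (∀ x, 0 < a₀ x) → (∀ x, 0 < θ₀ x) → ∃ σ₀ : ℝ, 0 < σ₀ ∧ ∀ σ : ℝ, 0 < σ → σ < σ₀ → ∀ Φ : (N : ℕ) → Flow σ N, ∀ τ : ℝ, 0 < τ → ∀ η' δ' : ℝ, 0 < η' → 0 < δ' → ∀ r : ℝ, 0 < r → ∃ M : ℕ, 0 < M ∧ ∃ N₀ : ℕ, ∀ N : ℕ, N₀ ≤ N → ∃ c : Fin M → (ℝ → T3 → ℝ), localGibbsLaw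 σ a₀ u₀ θ₀ N (Φ N) {z | ∀ j : Fin M, ∃ s ∈ Set.Icc (0 : ℝ) τ, ∃ x : T3, η' < |rhoC r ((Φ N).flow s z) x - c j s x|} ≤ ENNReal.ofReal δ' := by
  intro a₀ θ₀ u₀ ha hθ hu ha0 hθ0
  refine ⟨1 / 2, by norm_num, fun σ _hσ hσ2 Φ τ hτ η' δ' hη' hδ' r hr => ?_⟩
  -- energy tightness under the local Gibbs law
  obtain ⟨K, _hK0, hK⟩ := densityNet_energyTight ha hθ hu ha0 hθ0 hσ2.le Φ
  -- constants at fixed `r`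
  set L : ℝ := 3 / (Real.pi * r ^ 4) with hLdef
  have hL : 0 < L := by positivity
  set V : ℝ := Real.sqrt (2 * K) with hVdef
  have hV : 0 ≤ V := Real.sqrt_nonneg _
  set q : ℝ := η' / 4 with hqdef
  have hq : 0 < q := by positivity
  set δx : ℝ := q / L with hδxdef
  have hδx : 0 < δx := by positivity
  have hδx' : L * δx = q := by rw [hδxdef]; field_simp
  set δt : ℝ := q / (L * (V + 1)) with hδtdef
  have hδt : 0 < δt := by positivity
  have hδt' : L * V * δt ≤ q := by
    calc L * V * δt ≤ L * (V + 1) * δt := by gcongr; linarith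
      _ = q := by rw [hδtdef]; field_simp
  -- finite nets of `𝕋³` and of `[0, τ]`
  obtain ⟨Sx, hSx⟩ := gridUp_euclidNet hδx
  obtain ⟨St, hSt, hSt'⟩ := gridUp_timeNet τ hδt
  have hτ0 : (0 : ℝ) ∈ Set.Icc (0 : ℝ) τ := ⟨le_rfl, hτ.le⟩
  obtain ⟨k₀, hk₀, -⟩ := hSt' 0 hτ0
  -- selectors of a net time / net point
  have hselT : ∀ s : ℝ, ∃ k : St, s ∈ Set.Icc (0 : ℝ) τ → |s - (k : ℝ)| ≤ δt := by
    intro s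
    by_cases hs : s ∈ Set.Icc (0 : ℝ) τ
    · obtain ⟨k, hk, hsk⟩ := hSt' s hs
      exact ⟨⟨k, hk⟩, fun _ => hsk⟩
    · exact ⟨⟨k₀, hk₀⟩, fun h => absurd h hs⟩
  choose kSel hkSel using hselT
  have hselX : ∀ x : T3, ∃ l : Sx, Torus.euclidDist x (l : T3) ≤ δx := by
    intro x
    obtain ⟨l, hl, hxl⟩ := hSx x
    exact ⟨⟨l, hl⟩, hxl⟩
  choose lSel hlSel using hselX
  -- quantisation levels and the finite family of centres
  set Nv : ℕ := ⌈3 / (Real.pi * r ^ 3) / q⌉₊ with hNvdef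
  have hMpos : 0 < Fintype.card (St × Sx → Fin (Nv + 1)) := Fintype.card_pos
  -- `N₀` from the energy tail
  have hev : ∀ᶠ N in atTop, localGibbsLaw σ a₀ u₀ θ₀ N (Φ N)
      {z | K < ((N + 1 : ℕ) : ℝ)⁻¹ * configEnergy z} < ENNReal.ofReal δ' :=
    (tendsto_order.1 hK).2 _ (ENNReal.ofReal_pos.2 hδ')
  obtain ⟨N₀, hN₀⟩ := eventually_atTop.1 hev
  refine ⟨Fintype.card (St × Sx → Fin (Nv + 1)), hMpos, N₀, fun N hN => ?_⟩
  refine ⟨fun j s x => (((Fintype.equivFin (St × Sx → Fin (Nv + 1))).symm j (kSel s, lSel x) : ℕ) : ℝ) * q, ?_⟩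
  set e := Fintype.equivFin (St × Sx → Fin (Nv + 1)) with hedef
  -- the sure inclusion: off `goodᶜ ∪ {K < energy}` the own rounded grid values are a good centre
  have hsub : {z : Phase N | ∀ j : Fin (Fintype.card (St × Sx → Fin (Nv + 1))), ∃ s ∈ Set.Icc (0 : ℝ) τ, ∃ x : T3,
        η' < |rhoC r ((Φ N).flow s z) x - ((e.symm j (kSel s, lSel x) : ℕ) : ℝ) * q|}
      ⊆ (Φ N).goodᶜ ∪ {z | K < ((N + 1 : ℕ) : ℝ)⁻¹ * configEnergy z} := by
    intro z hz
    by_cases hg : z ∈ (Φ N).good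
    swap
    · exact Or.inl hg
    by_cases hKz : ((N + 1 : ℕ) : ℝ)⁻¹ * configEnergy z ≤ K
    swap
    · exact Or.inr (not_le.1 hKz)
    exfalso
    -- the rounding of `z`'s own grid values
    let g : St × Sx → Fin (Nv + 1) := fun p =>
      ⟨min ⌊rhoC r ((Φ N).flow (p.1 : ℝ) z) (p.2 : T3) / q⌋₊ Nv, Nat.lt_succ_of_le (min_le_right _ _)⟩
    obtain ⟨s, hs, x, hfar⟩ := hz (e g)
    rw [e.symm_apply_apply] at hfar
    have hsk : |s - (kSel s : ℝ)| ≤ δt := hkSel s hs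
    have hxl : Torus.euclidDist x (lSel x : T3) ≤ δx := hlSel x
    set k : ℝ := (kSel s : ℝ) with hkdef
    set l : T3 := (lSel x : T3) with hldef
    set w : Phase N := (Φ N).flow s z with hwdef
    set wk : Phase N := (Φ N).flow k z with hwkdef
    -- link 1: centre `x` to net point `l` at time `s`
    have h1 : |rhoC r w x - rhoC r w l| ≤ q := by
      have h : |rhoC r w x - rhoC r w l| ≤ 3 / (Real.pi * r ^ 4) * Torus.euclidDist x l :=
        gridUp_abs_mollDensity_sub_le_centre hr w x l
      calc |rhoC r w x - rhoC r w l| ≤ 3 / (Real.pi * r ^ 4) * Torus.euclidDist x l := h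
        _ ≤ L * δx := mul_le_mul_of_nonneg_left hxl hL.le
        _ = q := hδx'
    -- link 2: time `s` to net time `k` at the net point (the Lipschitz clock)
    have h2 : |rhoC r w l - rhoC r wk l| ≤ q := by
      have hclock : |rhoC r w l - rhoC r wk l| ≤
          3 / (Real.pi * r ^ 4) * Real.sqrt (2 * (((N + 1 : ℕ) : ℝ)⁻¹ * configEnergy z)) * |s - k| :=
        gridUp_clock hr (Φ N) (stub_meanDisplacement (Φ N) hg) k s l
      exact hclock.trans ((capSub_clock_mono hL.le hKz hsk).trans hδt')
    -- link 3: the rounding at the net point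
    have hρ0 : 0 ≤ rhoC r wk l := DensityCapNegative.mollDensity_nonneg hr wk l
    have hρ1 : rhoC r wk l ≤ 3 / (Real.pi * r ^ 3) := DensityCapNegative.mollDensity_le hr wk l
    have hfloor_le : ⌊rhoC r wk l / q⌋₊ ≤ Nv :=
      (Nat.floor_le_ceil _).trans (Nat.ceil_mono (div_le_div_of_nonneg_right hρ1 hq.le))
    have hgval : ((g (kSel s, lSel x) : ℕ) : ℝ) = (⌊rhoC r wk l / q⌋₊ : ℝ) := by
      show ((min ⌊rhoC r wk l / q⌋₊ Nv : ℕ) : ℝ) = _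
      rw [min_eq_left hfloor_le]
    have h3 : |rhoC r wk l - ((g (kSel s, lSel x) : ℕ) : ℝ) * q| ≤ q := by
      rw [hgval]
      have hfl : (⌊rhoC r wk l / q⌋₊ : ℝ) ≤ rhoC r wk l / q := Nat.floor_le (div_nonneg hρ0 hq.le)
      have hfl' : rhoC r wk l / q < ⌊rhoC r wk l / q⌋₊ + 1 := Nat.lt_floor_add_one _
      have hlo : (⌊rhoC r wk l / q⌋₊ : ℝ) * q ≤ rhoC r wk l := by
        have := mul_le_mul_of_nonneg_right hfl hq.le
        rwa [div_mul_cancel₀ _ hq.ne'] at this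
      have hhi : rhoC r wk l < ((⌊rhoC r wk l / q⌋₊ : ℝ) + 1) * q := by
        have := mul_lt_mul_of_pos_right hfl' hq
        rwa [div_mul_cancel₀ _ hq.ne'] at this
      rw [abs_le]
      constructor <;> nlinarith
    -- chaining
    have hε : q + q + q < η' := by rw [hqdef]; linarith
    have t1 := abs_sub_le (rhoC r w x) (rhoC r w l) (((g (kSel s, lSel x) : ℕ) : ℝ) * q)
    have t2 := abs_sub_le (rhoC r w l) (rhoC r wk l) (((g (kSel s, lSel x) : ℕ) : ℝ) * q)
    have hnear : |rhoC r w x - ((g (kSel s, lSel x) : ℕ) : ℝ) * q| ≤ q + q + q := by linarith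
    exact absurd hfar (not_lt.2 (hnear.trans hε.le))
  calc localGibbsLaw σ a₀ u₀ θ₀ N (Φ N) {z : Phase N | ∀ j : Fin (Fintype.card (St × Sx → Fin (Nv + 1))),
          ∃ s ∈ Set.Icc (0 : ℝ) τ, ∃ x : T3, η' < |rhoC r ((Φ N).flow s z) x - ((e.symm j (kSel s, lSel x) : ℕ) : ℝ) * q|}
      ≤ localGibbsLaw σ a₀ u₀ θ₀ N (Φ N) ((Φ N).goodᶜ ∪ {z | K < ((N + 1 : ℕ) : ℝ)⁻¹ * configEnergy z}) :=
        measure_mono hsub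
    _ ≤ localGibbsLaw σ a₀ u₀ θ₀ N (Φ N) (Φ N).goodᶜ +
          localGibbsLaw σ a₀ u₀ θ₀ N (Φ N) {z | K < ((N + 1 : ℕ) : ℝ)⁻¹ * configEnergy z} :=
        measure_union_le _ _
    _ ≤ 0 + ENNReal.ofReal δ' :=
        add_le_add (le_of_eq (gridUp_localGibbsLaw_compl_good σ a₀ θ₀ u₀ N (Φ N))) (hN₀ N hN).le
    _ = ENNReal.ofReal δ' := zero_add _

end Summit.AtomisticToContinuum.HydrodynamicLimit.Theorems.LocalSecondLawContact

end
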